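import Summits.KontsevichZagierPeriods.KontsevichZagierPeriods.Theorems.HurwitzMicroSectorsNormalFormPrincipleSplitMoves
import Summits.KontsevichZagierPeriods.KontsevichZagierPeriods.Theorems.AbelContractionRealHyperellipticSectorBudgetKit

/-!
# Route AbelContraction — `RealHyperellipticSector` (crux stmt-KontsevichZagierPeriods-12475):
# the dimension-certified port, layer 1 — moves for rational integrands with `ℚ`-split denominators

Helper file of the line `Lines/birth.lean` (stub `stub_bakerAlg`, `--supports` the crux): the port
of `Theorems/HurwitzMicroSectorsNormalFormPrincipleSplitMoves.lean` (namespace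
`…NormalFormPrinciple.PiBox.Dlog`) INTO THE BUDGET `KZ.relationsLE 1` — every statement
`… ∈ relations` of that file re-proved with the conclusion `… ∈ relationsLE 1`, each base move
carrying the certificate that all its representations have dimension `≤ 1` (rules 1a/1b/2 among
representations of dimension `1` or `0`, Newton–Leibniz `1 → 0`), via the budget kit
`…RealHyperellipticSectorBudgetKit.lean` and `AbelContractionAbelContractionLemma.lean`:

* point representations `[pt, r]` over `ℝ⁰`: additivity, zero, congruence
  (`pt_add_mem_relationsLE`, `pt_zero_mem_relationsLE`, `pt_congr_mem_relationsLE`);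
* **the Newton–Leibniz move over the point** for an interval representation whose integrand has a
  `ℚ`-rational primitive `F = P_F/Q_F` (`slab_sub_pt_mem_relationsLE`, registered sub-goal):
  `[(α,β), F'] ≡ [pt, F(β) − F(α)]` (rule 3 on the closed slab, `1 → 0`; rule 1a across the null
  endpoints);
* affine moves of either orientation (`affine_sub_mem_relationsLE`: `y = s x + t`, `s ≠ 0`).

The dimension-free lemmas of the original (`exists_ptCarrier`, `value_pt`,
`isSemialgebraicFunOn_polynomial_div`, `isSemialgebraic_Icc₁`, `image_affine_slab_of_pos/neg`,
`exists_rep_unit`) are reused by importing it; names and hypotheses are those of the original with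
`relations ↦ relationsLE`.

Sources: M. Kontsevich, D. Zagier, *Periods* (2001), §1.2 rules (1)–(3) [KontsevichZagier2001].
No definitions are introduced.
-/

noncomputable section

open MeasureTheory Set
open scoped Polynomial
open Literature.NumberTheory.Transcendental Literature.NumberTheory.Transcendental.KZ
open Literature.ModelTheory.ExponentialFields (IsSemialgebraic isSemialgebraic_univ)
open Summit.KontsevichZagierPeriods.AbelContraction.AbelContractionLemma
  (mem_relationsLE_of_integrandAdd of_mem_relationsLE_of_eqOn_zero)

namespace Summit.KontsevichZagierPeriods.AbelContraction.RealHyperellipticSector.Port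

namespace Dlog

open Literature.NumberTheory.Transcendental.KZ.BallPeeling (isSemialgebraic_Ioo₁)
open Summit.KontsevichZagierPeriods.KontsevichZagierPeriods.BetaCancellationLine
  (aff_hasFDerivAt_chart aff_injective_chart aff_isSemialgebraicMapOn_chart)
open Summit.KontsevichZagierPeriods.HurwitzMicroSectors.NormalFormPrinciple.Negative
  (integrableOn_fin_one)
open Summit.KontsevichZagierPeriods.KontsevichZagierPeriods.BetaCancellationNegative
  (volume_setOf_apply_eq_zero)
open Summit.KontsevichZagierPeriods.HurwitzMicroSectors.NormalFormPrinciple.PiBox.Dlog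
  (isSemialgebraicFunOn_polynomial_div isSemialgebraic_Icc₁)

/-! ## Point representations `[pt, r]` inside the budget -/

/-- Additivity of point representations: `[pt, r + r'] − [pt, r] − [pt, r'] ∈ relationsLE 1`
(rule 1b among representations of dimension `0`) (inside the budget `relationsLE 1`).
[cite: KontsevichZagier2001, §1.2 rule (1)] -/
theorem pt_add_mem_relationsLE {r r' : ℝ} (Z Z₁ Z₂ : IntegralRep 0) (hd : Z.domain = univ)
    (hd₁ : Z₁.domain = univ) (hd₂ : Z₂.domain = univ) (hi : Z.integrand = fun _ => r + r')
    (hi₁ : Z₁.integrand = fun _ => r) (hi₂ : Z₂.integrand = fun _ => r') :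
    of Z - of Z₁ - of Z₂ ∈ relationsLE 1 :=
  mem_relationsLE_of_integrandAdd zero_le_one (hd₁.trans hd.symm) (hd₂.trans hd.symm)
    fun x _ => by simp [hi, hi₁, hi₂]

/-- `[pt, 0] ∈ relationsLE 1` (inside the budget `relationsLE 1`).
[cite: KontsevichZagier2001, §1.2 rule (1)] -/
theorem pt_zero_mem_relationsLE (Z : IntegralRep 0) (hi : Z.integrand = fun _ => (0:ℝ)) :
    of Z ∈ relationsLE 1 :=
  of_mem_relationsLE_of_eqOn_zero zero_le_one Z (by rw [hi]; exact fun _ _ => rfl)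

/-- Congruence of point representations with the same constant (inside the budget `relationsLE 1`).
[cite: KontsevichZagier2001, §1.2] -/
theorem pt_congr_mem_relationsLE {r : ℝ} (Z Z' : IntegralRep 0) (hd : Z.domain = univ)
    (hd' : Z'.domain = univ) (hi : Z.integrand = fun _ => r) (hi' : Z'.integrand = fun _ => r) :
    of Z - of Z' ∈ relationsLE 1 :=
  Budget.congr_mem_relationsLE zero_le_one (hd'.trans hd.symm)
    (by rw [hi, hi']; exact fun _ _ => rfl)

/-! ## The Newton–Leibniz move over the point, for a `ℚ`-rational primitive, inside the budget -/

/-- **Newton–Leibniz over the point** (rule 3 from dimension `1` to dimension `0`, plus the null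
endpoints, rule 1a in dimension `1`) (inside the budget `relationsLE 1`; registered sub-goal of crux
stmt-KontsevichZagierPeriods-12475, port of `PiBox.Dlog.slab_sub_pt_mem_relations`). Let `α ≤ β`
be rational, `N = [(α,β), f]` an interval representation whose integrand `x ↦ f(x₀)` is
`ℚ`-semialgebraic on the closed slab, and `F = P_F/Q_F` (`P_F, Q_F ∈ ℚ[X]`, `Q_F ≠ 0` on `[α,β]`)
a primitive of `f` on `(α,β)`. Then `[N] − [pt, F(β) − F(α)] ∈ relationsLE 1` for every point
representation with that constant. [cite: KontsevichZagier2001, §1.2 rule (3)] -/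
theorem slab_sub_pt_mem_relationsLE : ∀ {α β : ℚ}, α ≤ β → ∀ (f : ℝ → ℝ) (PF QF : Polynomial ℚ),
    (∀ t ∈ Set.Icc (α:ℝ) β, (Polynomial.aeval t QF : ℝ) ≠ 0) →
    (∀ t ∈ Set.Ioo (α:ℝ) β,
      HasDerivAt (fun u : ℝ => (Polynomial.aeval u PF : ℝ) / Polynomial.aeval u QF) (f t) t) →
    IsSemialgebraicFunOn ℚ {x : Fin 1 → ℝ | x 0 ∈ Set.Icc (α:ℝ) β} (fun x => f (x 0)) →
    ∀ (N : KZ.IntegralRep 1), N.domain = {x | x 0 ∈ Set.Ioo (α:ℝ) β} →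
    Set.EqOn N.integrand (fun x => f (x 0)) N.domain →
    ∀ (Z : KZ.IntegralRep 0), Z.domain = Set.univ →
    (Z.integrand = fun _ => (Polynomial.aeval (β:ℝ) PF : ℝ) / Polynomial.aeval (β:ℝ) QF -
      (Polynomial.aeval (α:ℝ) PF : ℝ) / Polynomial.aeval (α:ℝ) QF) →
    KZ.of N - KZ.of Z ∈ KZ.relationsLE 1 := by
  intro α β hαβ f PF QF hQF hderiv hf N hNd hNi Z hZd hZi
  set F : ℝ → ℝ := fun u => (Polynomial.aeval u PF : ℝ) / Polynomial.aeval u QF with hF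
  set C : Set (Fin 1 → ℝ) := {x | x 0 ∈ Set.Icc (α:ℝ) β} with hC
  have hCsa : IsSemialgebraic ℚ C := isSemialgebraic_Icc₁ α β
  -- the integrand `f` on the closed slab is integrable (it is `N.integrand` a.e.)
  have hfi : IntegrableOn (fun x : Fin 1 → ℝ => f (x 0)) C := by
    have h1 : IntegrableOn (fun x : Fin 1 → ℝ => f (x 0)) N.domain :=
      N.integrableOn.congr_fun hNi (IsSemialgebraic.measurableSet_holds N.isSemialgebraic_domain)
    rw [hNd, integrableOn_fin_one] at h1
    rw [hC, integrableOn_fin_one]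
    exact h1.congr_set_ae (Ioo_ae_eq_Icc (a := (α:ℝ)) (b := β)).symm
  -- the closed-slab representation `R = [[α,β], f]`
  obtain ⟨R, hRd, hRi⟩ : ∃ R : IntegralRep 1, R.domain = C ∧ R.integrand = fun x => f (x 0) :=
    ⟨⟨C, fun x => f (x 0), hCsa, hf, hfi⟩, rfl, rfl⟩
  have hs0 : ∀ (x : Fin 0 → ℝ) (t : ℝ), (Fin.snoc x t : Fin 1 → ℝ) 0 = t := fun _ _ => rfl
  have hαβ' : (α:ℝ) ≤ β := by exact_mod_cast hαβ
  -- (i) ONE Newton–Leibniz move `1 → 0` over `ℝ⁰`: `[R] − [Z] ∈ relationsLE 1`, primitive `F (z 0)`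
  have hNL : of R - of Z ∈ relationsLE 1 := by
    refine Budget.newtonLeibniz_mem_relationsLE le_rfl (fun _ => (α:ℝ)) (fun _ => (β:ℝ))
      (fun z => F (z 0)) ?_ ?_ ?_ (fun _ _ => hαβ') ?_ ?_ ?_ ?_
    · rw [hRd]
      exact isSemialgebraicFunOn_polynomial_div hCsa PF QF fun x hx => hQF (x 0) hx
    · rw [hZd]
      simpa using isSemialgebraicFunOn_aeval (isSemialgebraic_univ (k := ℚ) (ι := Fin 0) (R := ℝ))
        (MvPolynomial.C α)
    · rw [hZd]
      simpa using isSemialgebraicFunOn_aeval (isSemialgebraic_univ (k := ℚ) (ι := Fin 0) (R := ℝ))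
        (MvPolynomial.C β)
    · rw [hRd, hZd, hC]
      ext z
      simp only [Set.mem_setOf_eq, Set.mem_Icc, Set.mem_univ, true_and]
      rfl
    · -- continuity of `t ↦ F t` on the closed fibre
      intro x _
      simp only [hs0]
      exact ((Polynomial.continuous_aeval PF).continuousOn).div
        (Polynomial.continuous_aeval QF).continuousOn hQF
    · -- derivative on the open fibre
      intro x _ t ht
      rw [hRi]
      simp only [hs0]
      exact hderiv t ht
    · intro x _
      rw [hZi]
      simp only [hs0]
      rfl
  -- (ii) closed slab versus the open slab `N.domain` (null endpoints), and congruence with `N`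
  have hEsub : {x : Fin 1 → ℝ | x 0 ∈ Set.Ioo (α:ℝ) β} ⊆ R.domain := by
    rw [hRd, hC]
    exact fun x hx => Set.Ioo_subset_Icc_self hx
  have hnull : volume (R.domain \ {x : Fin 1 → ℝ | x 0 ∈ Set.Ioo (α:ℝ) β}) = 0 := by
    refine measure_mono_null (fun x hx => ?_)
      (measure_union_null (volume_setOf_apply_eq_zero (0 : Fin 1) (α:ℝ))
        (volume_setOf_apply_eq_zero (0 : Fin 1) (β:ℝ)))
    rw [hRd, hC] at hx
    obtain ⟨⟨h1, h2⟩, h3⟩ := hx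
    simp only [Set.mem_setOf_eq, Set.mem_Ioo, not_and, not_lt] at h3
    simp only [Set.mem_union, Set.mem_setOf_eq]
    rcases h1.lt_or_eq with h1 | h1
    · exact Or.inr (le_antisymm h2 (h3 h1))
    · exact Or.inl h1.symm
  have h2 : of R - of (R.restrict _ (isSemialgebraic_Ioo₁ α β) hEsub) ∈ relationsLE 1 :=
    Budget.of_sub_of_restrict_mem_relationsLE le_rfl R (isSemialgebraic_Ioo₁ α β) hEsub hnull
  have h3 : of (R.restrict _ (isSemialgebraic_Ioo₁ α β) hEsub) - of N ∈ relationsLE 1 :=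
    Budget.congr_mem_relationsLE le_rfl (by rw [hNd]; rfl) fun x hx => by
      rw [IntegralRep.integrand_restrict, hRi, hNi (by rw [hNd]; exact hx)]
  have : of N - of Z = (of R - of Z) - (of R - of (R.restrict _ (isSemialgebraic_Ioo₁ α β) hEsub)) -
      (of (R.restrict _ (isSemialgebraic_Ioo₁ α β) hEsub) - of N) := by abel
  rw [this]
  exact (relationsLE 1).sub_mem ((relationsLE 1).sub_mem hNL h2) h3

/-! ## Affine moves of either orientation inside the budget -/

/-- **Affine move** (rule 2 among representations of dimension `1`), either orientation
(inside the budget `relationsLE 1`): if `Φ(x) = s x + t` (`s ≠ 0`, `s, t ∈ ℚ`) maps the slab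
`N.domain` onto `L.domain` and `N`'s integrand is the pull-back `f(Φ x)·|s|` of `L`'s integrand
`f`, then `[N] − [L] ∈ relationsLE 1`. [cite: KontsevichZagier2001, §1.2 rule (2)] -/
theorem affine_sub_mem_relationsLE {s t : ℚ} (hs : s ≠ 0) (N L : IntegralRep 1) (f : ℝ → ℝ)
    (himage : L.domain = (fun y : Fin 1 → ℝ => fun _ : Fin 1 => (s:ℝ) * y 0 + t) '' N.domain)
    (hLi : EqOn L.integrand (fun x => f (x 0)) L.domain)
    (hNi : EqOn N.integrand (fun x => f ((s:ℝ) * x 0 + t) * |(s:ℝ)|) N.domain) :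
    of N - of L ∈ relationsLE 1 := by
  have hs' : (s:ℝ) ≠ 0 := by exact_mod_cast hs
  have hdet : |((s:ℝ) • ContinuousLinearMap.id ℝ (Fin 1 → ℝ)).det| = |(s:ℝ)| := by
    have : ((s:ℝ) • ContinuousLinearMap.id ℝ (Fin 1 → ℝ)).det = (s:ℝ) := by
      change LinearMap.det (((s:ℝ) • ContinuousLinearMap.id ℝ (Fin 1 → ℝ) :
        (Fin 1 → ℝ) →L[ℝ] (Fin 1 → ℝ)) : (Fin 1 → ℝ) →ₗ[ℝ] (Fin 1 → ℝ)) = (s:ℝ)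
      rw [ContinuousLinearMap.toLinearMap_smul, ContinuousLinearMap.coe_id,
        LinearMap.det_smul, LinearMap.det_id, Module.finrank_fin_fun]
      ring
    rw [this]
  refine Budget.changeOfVariables_mem_relationsLE le_rfl
    (fun y : Fin 1 → ℝ => fun _ : Fin 1 => (s:ℝ) * y 0 + t)
    (fun _ => (s:ℝ) • ContinuousLinearMap.id ℝ (Fin 1 → ℝ))
    (aff_isSemialgebraicMapOn_chart N.isSemialgebraic_domain (isAlgebraic_algebraMap t)
      (isAlgebraic_algebraMap s))
    (fun x _ => (aff_hasFDerivAt_chart (s:ℝ) t x).hasFDerivWithinAt)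
    (aff_injective_chart hs' (t:ℝ)).injOn himage fun x hx => ?_
  have hΦx : (fun _ : Fin 1 => (s:ℝ) * x 0 + t) ∈ L.domain := himage ▸ Set.mem_image_of_mem _ hx
  rw [hNi hx, hLi hΦx, hdet]

end Dlog

end Summit.KontsevichZagierPeriods.AbelContraction.RealHyperellipticSector.Port

end
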